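import Summits.BirchSwinnertonDyer.Rank1Residual.X4.KolyvaginIndexRecordsKitOddPrime
import HarnessLib

/-!
# BSD rank-≤1 residual cell, lane class X11b (`p ∥ N`: MULTIPLICATIVE at a prime `p ≥ 5`, `ρ̄_{E,p}` onto), rank ONE, KOLY-shaped: `BSD(E,p)`
# PER CELL from PUBLISHED theorems + Kolyvagin's HEEGNER-INDEX certificate `p ∤ [E(K):ℤy_K]` (two engines) through the unit's GEN 27 kit
# `X4.bsdp_prime_of_kolyvaginIndex_of_serreCounts`, `ρ̄_{E,p}` onto IN THE KERNEL — records 02 (x11c GEN 36 «J1-REMAINDER / KOLY-R»)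

HONEST FRAMING (cell `b2b-bsdres-*`, verbatim): prove what is provable now; shrink each hard class to its core with data; no claim beyond
stated classes; COMBINATION classes deleted from PUBLISHED theorems only, CONSTRUCTION-shaped remainder typed; this is not "finishing BSD".
X4 / X11b (and X11 ∧ r = 1 ∧ p = 3) stay CONSTRUCTION-SHAPED; everything here is PER CELL; no lane verdict is changed; NO named fact is
introduced (debt 0) and NO definition; nothing is booked by this file (bookings are referee A's, pub-bsdpct); Cremona's numbers (`r_an`,
`#Ш_an`, models, generators, `∏ c_ℓ`, torsion, optimality / Manin codes, the galrep datum) and the Kurihara lane's per-prime tables are INPUTS.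

Unit `b2b-bsdres-x11c`, GEN 36 (prover-b2b-bsdres-x11c-g36-0), move «J1-REMAINDER / KOLY-R». POPULATION (`HOME/b2b-bsdres-x11c/gen36/pop/`:
`census36.py` over referee A's ROUND 983 state of record × the Kurihara lane's sweep records × Cremona, then `build_pop36.py`): EVERY live
residue cell on the Kolyvagin / Jetchev road classes (X4, X7, X8, X11a, X11b), BOTH ranks, odd `p`, whose shape is KOLY (`ρ̄_{E,p}` onto,
`p ∤ #E(ℚ)_tors·∏c·#Ш_an`: 30 cells) or J1 (onto, `p ∤ #E(ℚ)_tors·#Ш_an`, exactly ONE prime `q ∣ N` with `p ∣ c_q`: 171 cells; the two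
J1 cells whose carrier is an ADDITIVE `p` have no door and are excluded) — 199 cells on 191 classes (188 of them with this cell as their ONLY
open cell): 82 rank-one `(3, X11b)`, 59 `(5, X4)` + 2 `(7, X4)` (rank one 19 / rank zero 42), 26 `(3, X4)` J1 (1 / 25), 20 `(3, X4)` KOLY
(6 / 14), 10 KOLY at `p ≥ 5`. The lane never certified them: at rank one its Heegner fields (`|D| ≤ 1511`) read `ord_p [E(K):ℤy_K] = w + 1`
or found no admissible field; at rank zero (additive `p`) no Heegner-index line was ever run. THIS UNIT ran the cell's engines VERBATIM in
DEEPER fields: engine 1 = gen 3 `engine1_cha1b/main.py` = x9-g7 `jobD1b.py` (cypari2, sha256 `69e29ec7…`; rank-one mode: Cremona's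
generator, `hy = L'(E,1)·L(E^D,1)·√|D|/(4·Area)`, `m = √(4·hy/ĥ(P))`; rank-zero mode: the rank-one twist `F = E^D`, a point `x ∈ F(ℚ)` by
`ellrank`, saturated, `hy = L(E,1)·L'(F,1)·√|D|/(4·Area)`, `m = √(4·hy/ĥ(x))` — Miller 2011 Thm. 4.1 / Cor. 4.8; `NDISC 16`, `DBOUND 6000`);
engine 2 = gen 3 `run_cert.py` (`1b54bb20…`) + `e2lib.py` + `tate_stdlib.py` (stdlib re-implementation: `m`, `ord_p m` must be EQUAL,
discrete checks); twist values = additive-p1 `twistvals/main.py` (`e501b988…`). Kit jobs: e1r1a j293228 · e1r1b j293234 · e1r1c j293239 · e1r0a j293243 · e1r0b j293245 · tamB j293413 · e2r0q0 j293852 · e2r0q1 j293855 · tv0 j293857 · e1r0vd j293870 · e2r1a j293889 · tva j293892 · e2r1b j294065 · tvb j294066 · e2r0vd j294269 · tv0vd j294272 · e2r1c j294330 · tvc j294332 · e1r0vd2 j294377. Evidence `HOME/b2b-bsdres-x11c/gen36/`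
(POP36.md, ROWS36-TABLE.md, harvest outputs with inputs.sha256, SHA256SUMS); REPORT.md §45.

THE ROAD (the unit's GEN 26/27/32 Kolyvagin route, class-agnostic, at `p ≥ 5`; referee A booked its X11b / X4 / X7 rows flag-free at pub-bsdpct
ROUNDS 429 / 651 / 835 / 839 in the KOLYD-r1 grammar): Kolyvagin's theorem as PRINTED by McCallum (LMS LN 153 (1991) §1) / Gross (ibid., Prop. 2.1 (2)) —
tree named facts `kolyvagin`, `Kolyvagin1990_padicValNat_card_sha_le` (registry A20; NOTHING about the reduction of `E` at `p`): `p ∤ [E(K):ℤy_K]` ⇒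
`Ш(E/K)[p] = 0` ⇒ `Ш(E/ℚ)[p] = 0`, and with `ord_p #Ш_an = 0` Miller's `BSD(E,p)` (`Typed.bsdp_of_kolyvagin_of_not_dvd_index`, `r_an ≤ 1`).
IN THE KERNEL per cell (kit `X4.bsdp_prime_of_kolyvaginIndex_of_serreCounts`, `X4/KolyvaginIndexRecordsKitOddPrime.lean`, p391900; every numeric
hypothesis a `decide` goal): `Δ ≠ 0`; global minimality of Cremona's model (bounded Kraus criterion, `|Δ| < 512¹²`); `ρ̄_{E,p}` ONTO by Serre's
Prop. 19 from THREE witness primes (schema point counts). DISPLAYED (binders, LETTER FOR LETTER the tuple of the unit's `X11b.bsdp_k<label>_<p>` /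
`X4.bsdp_k<label>_<p>` records): `hGZK`, `hKo` / `hB`, the Heegner datum (`K`, level `N`, `P` of infinite order, `p ∤ [E(K):ℤP]` — THIS UNIT's
two-engine datum, quoted per docstring, NOT re-computed here), `r_an ≤ 1`, `#Ш_an = q` with `ord_p q = 0`.
What a record is worth is the referee's call (EVIDENCE-grade certificate under displayed binders, as every Heegner-index record of the
cell). Cells in this file: `456330b1`@53.

References: D. Jetchev, Compos. Math. 144 (2008) Thm. 1.4, Cor. 1.5 [Jetchev2008]; W. McCallum, LMS LN 153 (1991) §1, Cor. 5.6
[McCallumLMS1991]; B. H. Gross, LMS LN 153 (1991) Prop. 2.1 [GrossLMS1991]; V. A. Kolyvagin (1990) [KolyvaginEulerSystems1990];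
J.-P. Serre, Invent. Math. 15 (1972) §2.4 Prop. 15, §2.8 Prop. 19 [Serre1972]; J.-P. Serre, *Abelian ℓ-adic representations* IV-23
[SerreAbelianLadic1968]; B. H. Gross, D. Zagier, Invent. Math. 84 (1986) [GrossZagier1986]; R. L. Miller, LMS J. Comput. Math. 14 (2011)
Thm. 4.1, Cor. 4.8, Def. 1.1 [Miller2011LMS]; C. Wuthrich, Doc. Math. 19 (2014) Lemma 20 [Wuthrich2014]; J. H. Silverman, *AEC* (2009)
VII.1, VII.5 [SilvermanAEC2009], *ATAEC* (1994) IV.9.4 [SilvermanATAEC1994]; A. Kraus, Acta Arith. 54 (1989) [Kraus1989]; Cremona's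
tables [Cremona2006].
-/

set_option autoImplicit false

noncomputable section

open scoped Classical

open WeierstrassCurve Literature.NumberTheory.EllipticCurves
  Literature.NumberTheory.EllipticCurves.Rank1Residual
  Literature.NumberTheory.EllipticCurves.Rank1Residual.Typed
  Literature.NumberTheory.EllipticCurves.Rank1Residual.X11RankOneCertificates
  Summit.BirchSwinnertonDyer.BirchSwinnertonDyer.Rank1Residual.IntModel
  Summit.BirchSwinnertonDyer.BirchSwinnertonDyer.Rank1Residual.X11RankOne
  Summit.BirchSwinnertonDyer.Rank1Residual.X4

namespace Summit.BirchSwinnertonDyer.Rank1Residual.X11b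

/-- **`BSD(E,53)` for `456330b1`** (cell `(456330b1, 53)`, class X11b, rank 1; KOLYD grammar key `KOLY:456330b1@53`); `N = 456330 = 2·3·5·7·41·53`,
nonsplit `I1` at `53`, `r_an = 1`, `#E(ℚ)_tors = 2`, `∏c = 48`, `#Ш_an = 1`, Cremona galrep: no code at this prime (`ρ̄_{E,53}` onto); `|Δ| = ∏`
over `[(2, 10), (3, 7), (5, 4), (7, 2), (41, 6), (53, 1)]` (factored Kraus criterion, every disjunct decided). KOLY-shaped: `53 ∤
#E(ℚ)_tors·∏c·#Ш_an`; door `X4.bsdp_prime_of_kolyvaginIndex_of_serreCounts` (the unit's GEN 27 kit, class-agnostic: Kolyvagin as printed, `53 ∤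
[E(K):ℤy_K]` ⇒ `Ш(E/ℚ)[53] = 0`; bounded Kraus minimality `|Δ| < 512¹²`); displayed certificate line `hI : ¬ 53 ∣ [E(K):ℤP]`. Serre Prop-19
witnesses mod `53`: (i) `ℓ₁ = 11`, `#Ẽ = 14`, `r = 15`; (ii) `ℓ₂ = 17`, `#Ẽ = 12`; (iii) `ℓ₃ = 11`, `#Ẽ = 14`, `u = 10`. Kurihara lane note of
record: «multiplicative p, r=1, irr (Castella 2018 Thm A withdrawn for p||N)». State of record (referee A ROUND 983,
`scratchA_A_state_after_x4gh_add3_onA2R977_fold.pkl`): class `residue`, 5 open cell(s), register ('JSW-ss', 'tail'). FLAG `opt-code-2` (Cremona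
optimality code 2; `ρ̄_{E,53}` onto forbids a `53`-isogeny in the class, so `ord_53` of the index is class-invariant; the reading stands if the
optimal curve's Manin constant is prime to `53`). Other engine-1 fields tried (`D`: `m` (`ord_53 m`)): none. THIS UNIT'S DATUM (displayed, NOT
re-computed here): DEEP FIELD `K = ℚ(√-1679)` (`1679` = 23·73): **`m = [E(K):ℤy_K] = 288`, `ord_53 m = 0`** (`ρ = m²/4`, `L'(E,1) = 2.3504516266`,
`L(E^D,1) = 4.2471067543`, `ĥ(P) = 1.8121232417`; Cremona's generator) — engine 1 j293228 = engine 2 j293889: `m = 288` EQUAL (AGREE v_p(m)=0, dev ≤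
1.9e-13); twist `E^D` (j293892): `N = 1286412979530`, `#tors·∏c·#Ш_an = 2·384·36`, `ord_53 #Ш_an(E^D) = 0`, `ord_53 ∏c(E^D) = 0` (BSD-consistent).
CONDITIONAL on every binder; per cell; nothing booked by this file.
[cite: McCallumLMS1991, §1 Theorem (Kolyvagin), p. 296] [cite: GrossLMS1991, §2 Prop. 2.1 (2)] [cite: Serre1972, §2.8 Prop. 19] [cite: Cremona2006, Table 1 (label 456330b1)] -/
theorem bsdp_k456330b1_53 (hGZK : rank_eq_analyticRank_of_analyticRank_le_one) (W : WeierstrassCurve ℚ)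
    (hW : W = ⟨1, 1, 0, -3636843, 6861071997⟩) {N : ℕ} [NeZero N] {K : Type} [Field K] [NumberField K]
    (hKo : kolyvagin N W K) (hB : Kolyvagin1990_padicValNat_card_sha_le N W K) (hK : IsImaginaryQuadratic K)
    (hH : SatisfiesHeegnerHypothesis N K) {P : (W.baseChange K).toAffine.Point} (hP : IsHeegnerPoint N W K P)
    (hnt : ¬ IsOfFinAddOrder P) (hI : ¬ 53 ∣ (AddSubgroup.zmultiples P).index) (hr : W.analyticRank ≤ 1)
    {q : ℚ} (hq : shaAn W = (q : ℂ)) (hv : padicValRat 53 q = 0) : BSDp W 53 :=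
  bsdp_prime_of_kolyvaginIndex_of_serreCounts 53 (by norm_num) (by norm_num) 1 1 0 (-3636843) 6861071997 (by decide +kernel)
    (by decide +kernel) (by decide +kernel) 11 17 11 (by norm_num) (by norm_num) (by norm_num) (by norm_num)
    (by norm_num) (by norm_num) (by norm_num) (by norm_num) (by norm_num) (by decide +kernel) (by decide +kernel)
    (by decide +kernel) (n₁ := 14) (n₂ := 12) (n₃ := 14) (hc₁ := by decide +kernel) (hc₂ := by decide +kernel)
    (hc₃ := by decide +kernel) (by decide +kernel) (by decide +kernel) (by decide +kernel) hGZK W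
    (by rw [hW]; norm_num) hKo hB hK hH hP hnt hI hr hq hv

end Summit.BirchSwinnertonDyer.Rank1Residual.X11b

end
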